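import Mathlib.Geometry.Manifold.Algebra.Monoid
import Literature.Analysis.FunctionSpaces.HolderSpaceManifold
import HarnessLib

/-!
# Members of `C^{k,r}_𝔄(M, F)` are `C^k` on the manifold (Hölder spaces, part 14)

Topic `Literature/Analysis/FunctionSpaces`. A function `u : M → F` all of whose chart pieces
`𝔄.piece u i = 𝟙_{target_i} · (ρ_i u) ∘ chart_i⁻¹` are of class `C^k` on the model space (in
particular every member of `C^{k,r}_𝔄(M, F)`, part 4) is of class `C^k` on `M`
(`HolderManifoldFunction.contMDiff`): each `ρ_i u` is `C^k` — on the chart source it is the piece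
read through the (smooth) chart, off the support of `ρ_i` it vanishes — and `u = ∑ i ρ_i u`.
This lets the geometric operators of the tree (`g.hessian`, `g.dalembertian`, `mvfderiv`), whose
chart formulas are stated for `C^k` functions on `M`, be applied to members. Everything is proved;
no named facts. Brick (1d-ii-b₀) of the census of
`Literature.Geometry.Riemannian.gurskyViaclovsky_pathOpen_weighted_four`.

## References

* D. Joyce, *Riemannian Holonomy Groups and Calibrated Geometry* (2007), §1.2. [Joyce2007]
-/

noncomputable section

open Set Filter Topology Function
open scoped NNReal Manifold ContDiff

namespace Literature.Analysis.FunctionSpaces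

namespace HolderChartData

variable {ι : Type*} {E : Type*} [NormedAddCommGroup E] [NormedSpace ℝ E]
  {M : Type*} [TopologicalSpace M] [ChartedSpace E M] [IsManifold 𝓘(ℝ, E) ∞ M]
  (𝔄 : HolderChartData ι E M) {F : Type*} [NormedAddCommGroup F] [NormedSpace ℝ F] {k : ℕ}

/-- **`ρ_i • u` is `C^k` on `M` when the `i`-th piece is `C^k` on the model space**: on the chart
source it is `piece_i ∘ chart_i`, off `tsupport ρ_i` it vanishes. [folklore] -/
theorem contMDiff_rho_smul {u : M → F} (i : ι) (hp : ContDiff ℝ k (𝔄.piece u i)) :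
    ContMDiff 𝓘(ℝ, E) 𝓘(ℝ, F) k fun x => 𝔄.ρ i x • u x := by
  intro x
  by_cases hx : x ∈ (𝔄.chart i).source
  · -- near `x` the function is the piece read through the chart
    have hev : (fun x => 𝔄.ρ i x • u x) =ᶠ[𝓝 x] fun x => 𝔄.piece u i (𝔄.chart i x) := by
      filter_upwards [(𝔄.chart i).open_source.mem_nhds hx] with z hz
      exact 𝔄.smul_apply_eq_piece u hz
    refine ContMDiffAt.congr_of_eventuallyEq ?_ hev
    have hchart : ContMDiffAt 𝓘(ℝ, E) 𝓘(ℝ, E) k (𝔄.chart i) x :=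
      ((contMDiffOn_chart (n := ∞) (x := 𝔄.center i)).of_le
        (WithTop.coe_le_coe.mpr le_top)).contMDiffAt ((𝔄.chart i).open_source.mem_nhds hx)
    exact hp.comp_contMDiffAt hchart
  · -- off the support of `ρ_i` the function vanishes near `x`
    have hx' : x ∉ tsupport (𝔄.ρ i) := fun h => hx (𝔄.isSubordinate i h)
    have hev : (fun x => 𝔄.ρ i x • u x) =ᶠ[𝓝 x] fun _ => (0 : F) := by
      filter_upwards [notMem_tsupport_iff_eventuallyEq.1 hx'] with z hz
      simp [hz]
    exact (contMDiffAt_const (c := (0 : F))).congr_of_eventuallyEq hev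

/-- **A function with `C^k` chart pieces is `C^k` on `M`** (`u = ∑ i ρ_i u`). [folklore] -/
theorem contMDiff_of_contDiff_piece [Fintype ι] {u : M → F} (hp : ∀ i, ContDiff ℝ k (𝔄.piece u i)) :
    ContMDiff 𝓘(ℝ, E) 𝓘(ℝ, F) k u := by
  have heq : u = fun x => ∑ i, 𝔄.ρ i x • u x := by
    funext x
    exact (𝔄.sum_smul_eq x (u x)).symm
  rw [heq]
  exact contMDiff_finsetSum fun i _ => 𝔄.contMDiff_rho_smul i (hp i)

end HolderChartData

namespace HolderManifoldFunction

variable {ι : Type*} [Fintype ι] {E : Type*} [NormedAddCommGroup E] [NormedSpace ℝ E]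
  {M : Type*} [TopologicalSpace M] [ChartedSpace E M] [IsManifold 𝓘(ℝ, E) ∞ M]
  {𝔄 : HolderChartData ι E M} {F : Type*} [NormedAddCommGroup F] [NormedSpace ℝ F] {k : ℕ}
  {r : ℝ≥0}

/-- **Members of `C^{k,r}_𝔄(M, F)` are `C^k` on `M`.** [folklore] -/
theorem contMDiff (u : HolderManifoldFunction 𝔄 F k r) : ContMDiff 𝓘(ℝ, E) 𝓘(ℝ, F) k u :=
  𝔄.contMDiff_of_contDiff_piece fun i => (u.memContDiffHolder_piece i).1

/-- Members of `C^{k,r}_𝔄(M, F)` are continuous. [folklore] -/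
theorem continuous (u : HolderManifoldFunction 𝔄 F k r) : Continuous (u : M → F) :=
  u.contMDiff.continuous

/-- **The chart representative of a member is `C^k` on the chart target.** [folklore] -/
theorem contDiffOn_comp_symm (u : HolderManifoldFunction 𝔄 F k r) (i : ι) :
    ContDiffOn ℝ k (u ∘ (𝔄.chart i).symm) (𝔄.chart i).target := by
  rw [← contMDiffOn_iff_contDiffOn]
  exact u.contMDiff.comp_contMDiffOn
    ((contMDiffOn_chart_symm (n := ∞) (x := 𝔄.center i)).of_le (WithTop.coe_le_coe.mpr le_top))

end HolderManifoldFunction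

end Literature.Analysis.FunctionSpaces

end
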